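import Summits.AtomisticToContinuum.FouriersLaw.Theorems.JunctionLocalityNonBallisticOfZeroDrudeWeight

/-! Strategist s2 sketch: typed forms used in STRATEGY-CENSUS.md (crux stmt-AtomisticToContinuum-9127).
`Z` = the lead's open stub `stub_zeroDrudeWeightInfiniteChain` (zero Drude weight of the infinite chain, ∀ admissible pair);
`CurrentMixing` = the strengthening S⁺_pt (pointwise decay of the Green–Kubo integrand);
`crux_of_K_of_Z` re-checks the landed reduction (p150755). -/

noncomputable section
open MeasureTheory Filter Topology
open Literature.MathematicalPhysics.KineticTheory.HeatConduction

namespace Summit.AtomisticToContinuum.FouriersLaw.Cruxes.NonBallistic.StrategistS2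

/-- Z: zero Drude weight of the infinite pinned anharmonic chain (Cesàro form), for every admissible pair. -/
def Z : Prop :=
  ∀ ω₂ lam β γ : ℝ, 0 < ω₂ → 0 < lam → 0 < β → ∀ T : ℝ, 0 < T →
    ∀ μ : Measure ChainConfig, (pinnedChain ω₂ lam β γ).IsChainGibbsMeasure T μ → IsShiftInvariant μ →
      μ.map (fun σ : ChainConfig => fun x : ℤ => ((σ x).1, -(σ x).2)) = μ →
      ∀ D : InfiniteChainDynamics (pinnedChain ω₂ lam β γ), D.PreservesMeasure μ →
        (∀ t : ℝ, ∀ᵐ σ ∂μ, D.flow t (shift σ) = shift (D.flow t σ)) →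
        (∀ t : ℝ, D.HasAbsConvergentCorrelation μ t) →
        Tendsto (fun τ : ℝ => τ⁻¹ * ∫ t in (0:ℝ)..τ, D.currentCorrelation μ t) atTop (𝓝 0)

/-- S⁺_pt (strengthening): MIXING OF THE MACROSCOPIC CURRENT — the Green–Kubo integrand itself decays, `C_∞(t) → 0`
(Rajchman property of the current spectral measure; strictly stronger than `σ({0}) = 0`). Harmonic member: `C_∞(t) → D_harm > 0`. -/
def CurrentMixing : Prop :=
  ∀ ω₂ lam β γ : ℝ, 0 < ω₂ → 0 < lam → 0 < β → ∀ T : ℝ, 0 < T →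
    ∀ μ : Measure ChainConfig, (pinnedChain ω₂ lam β γ).IsChainGibbsMeasure T μ → IsShiftInvariant μ →
      μ.map (fun σ : ChainConfig => fun x : ℤ => ((σ x).1, -(σ x).2)) = μ →
      ∀ D : InfiniteChainDynamics (pinnedChain ω₂ lam β γ), D.PreservesMeasure μ →
        (∀ t : ℝ, ∀ᵐ σ ∂μ, D.flow t (shift σ) = shift (D.flow t σ)) →
        (∀ t : ℝ, D.HasAbsConvergentCorrelation μ t) →
        Tendsto (fun t : ℝ => D.currentCorrelation μ t) atTop (𝓝 0)

/-- S⁺_rate (strengthening): an algebraic Cesàro RATE, `|τ⁻¹∫₀^τ C_∞| ≤ A τ^{-a}` for some `a > 0` (Hölder control of the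
current spectral measure at frequency 0). -/
def CesaroRate : Prop :=
  ∀ ω₂ lam β γ : ℝ, 0 < ω₂ → 0 < lam → 0 < β → ∀ T : ℝ, 0 < T →
    ∀ μ : Measure ChainConfig, (pinnedChain ω₂ lam β γ).IsChainGibbsMeasure T μ → IsShiftInvariant μ →
      μ.map (fun σ : ChainConfig => fun x : ℤ => ((σ x).1, -(σ x).2)) = μ →
      ∀ D : InfiniteChainDynamics (pinnedChain ω₂ lam β γ), D.PreservesMeasure μ →
        (∀ t : ℝ, ∀ᵐ σ ∂μ, D.flow t (shift σ) = shift (D.flow t σ)) →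
        (∀ t : ℝ, D.HasAbsConvergentCorrelation μ t) →
        ∃ A a : ℝ, 0 < a ∧ ∀ τ : ℝ, 1 ≤ τ → |τ⁻¹ * ∫ t in (0:ℝ)..τ, D.currentCorrelation μ t| ≤ A * τ ^ (-a)

/-- The rate form implies Z (elementary). -/
theorem z_of_cesaroRate (h : CesaroRate) : Z := by
  intro ω₂ lam β γ hω hl hβ T hT μ hG hS hR D hP hc hA
  obtain ⟨A, a, ha, hb⟩ := h ω₂ lam β γ hω hl hβ T hT μ hG hS hR D hP hc hA
  rw [Metric.tendsto_atTop]
  intro ε hε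
  -- choose τ₀ ≥ 1 with A τ₀^{-a} < ε
  have hlim : Tendsto (fun τ : ℝ => A * τ ^ (-a)) atTop (𝓝 0) := by
    have := (tendsto_rpow_neg_atTop ha).const_mul A
    simpa using this
  obtain ⟨τ₁, hτ₁⟩ := (Metric.tendsto_atTop.mp hlim) ε hε
  refine ⟨max τ₁ 1, fun τ hτ => ?_⟩
  have h1 : 1 ≤ τ := le_trans (le_max_right _ _) hτ
  have h2 : τ₁ ≤ τ := le_trans (le_max_left _ _) hτ
  have hbnd := hb τ h1
  have hsmall := hτ₁ τ h2
  rw [Real.dist_eq, sub_zero] at hsmall ⊢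
  have hnn : 0 ≤ A * τ ^ (-a) := le_trans (abs_nonneg _) hbnd
  rw [abs_of_nonneg hnn] at hsmall
  exact lt_of_le_of_lt hbnd hsmall

/-- Re-check of the landed reduction (p150755): (K) ∧ Z ⇒ the crux, by name. -/
theorem crux_of_K_of_Z
    (hK : Summit.AtomisticToContinuum.FouriersLaw.Theses.BondHeatUncertainty.ExtensiveSnapshotIrreversibility) (hZ : Z) :
    Summit.AtomisticToContinuum.FouriersLaw.Theses.JunctionLocality.NonBallistic :=
  Summit.AtomisticToContinuum.FouriersLaw.Theorems.NonBallistic.nonBallistic_of_extensiveSnapshotIrreversibility_of_zeroDrudeWeight hK hZ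

/-- And (K) ∧ 11032 ∧ 11030 ⇒ the crux (the 3-way dedup family of this census). -/
theorem crux_of_K_of_11032_of_11030
    (hK : Summit.AtomisticToContinuum.FouriersLaw.Theses.BondHeatUncertainty.ExtensiveSnapshotIrreversibility)
    (h32 : Summit.AtomisticToContinuum.FouriersLaw.Theses.CurrentTiltQuench.DrudeFromTruncation)
    (h30 : Summit.AtomisticToContinuum.FouriersLaw.Theses.CurrentTiltQuench.NoTruncatedDrude) :
    Summit.AtomisticToContinuum.FouriersLaw.Theses.JunctionLocality.NonBallistic :=
  Summit.AtomisticToContinuum.FouriersLaw.Theorems.NonBallistic.nonBallistic_of_extensiveSnapshotIrreversibility_of_currentTiltQuench hK h32 h30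

end Summit.AtomisticToContinuum.FouriersLaw.Cruxes.NonBallistic.StrategistS2
end
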